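import Literature.MathematicalPhysics.QuantumFieldTheory.Balaban1983to89.B9Thm37GpTorusRegularEntries
import Literature.MathematicalPhysics.QuantumFieldTheory.Balaban1983to89.B9Thm37CutoffDivTerms

/-!
# `Balaban1983to89.B9Thm37GpTorusRegularEntriesCubes` — T. Bałaban, *Propagators for lattice gauge theories in a background field*, Commun.
# Math. Phys. **99** (1985) 389–434 [Balaban1985BackgroundPropagators], Theorem 3.7 (3.87)–(3.90) pp. 409–410 ⇒ ALL FOUR INEQUALITIES (3.42) OF
# THEOREM 3.1 FOR `G′(U)` AT THE CUBE COVER OF RECORD: the per-cube inputs `hT`, `h389`, `hTE μ`, `hTL`, `hTF μ` of `B9Thm37GpTorusRegularEntries`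
# DISCHARGED from the cube letters' (3.42) blocks over the invariant class (Cor. 3.6 for `G′_□`) and the sizes of the cut-offs `h_□`

statement-level skeleton of published theorems with citation tags; proofs where landed; nothing here is a claim about the Yang–Mills mass gap

PDF held: `paper:balaban1985-cmp99-background-propagators` (journal page = PDF page + 388); pp. 397, 403, 408–410 read from the held text layer;
[4] = [Balaban1984PropagatorsII] pp. 230–235.

THE PRINT.  p. 409 (3.87) *«G′₀ = Σ_{□∈𝒟} h_□G′_□h_□»*, (3.88) *«Δ′_aG′₀ = I − Σ_□ K(h_□)G′_□h_□ = I − R′»*, (3.90) *«G′ = G′₀(I − R′)⁻¹ = Σ_{n=0}^{∞} G′₀R′ⁿ»*;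
Theorem 3.7 p. 409: *«For M sufficiently large, and a configuration U satisfying (3.35), the operator G′ can be represented as [(3.90)] … The expansion is
convergent in all norms appearing in the inequalities (3.42)–(3.47)»*; p. 410: *«This theorem follows simply from Corollary 3.6 holding for all G′_□,
□ ∈ 𝒟, from the bound (3.89) and Lemma 2.1 … We can get a decay rate arbitrarily close to the decay rate of the localized propagators …
Theorem 3.7 implies that all the inequalities (3.42)–(3.47) hold for G′, thus we have completed the proof of Theorem 3.1»*; Thm 3.1 (3.42) p. 397:
*«|(G′(U)λ)(x)|, |(∇_UG′(U)λ)(x)|, |(G′(U)∇*_Uλ)(x)|, |(Δ_UG′(U)λ)(x)| ≤ B₀[(Lʲη)², Lʲη, Lʲη, 1]e^{−δ₀d(y,y′)}|λ| for x ∈ Δ(y), y ∈ Λ_j, supp λ ⊂ Δ(y′)»*;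
p. 403 *«of course with different constants»*; [4] Prop. 2.2 (2.65)–(2.67) p. 234, Lemma 2.1 (2.60)–(2.61) p. 234, (2.51) p. 232, (2.44) p. 230.

WHY THIS FILE (cell context: G-B9-LETTERS, module M5.5 FILE 4c = FILE 2 at the cube cover of record; consumer = M5.9 `LettersAt` fields gp_sup∕grad∕div∕lap,
R3 19200 P2).  FILE 2 `B9Thm37GpTorusRegularEntries.eBlock_kernelFamilySInv_Gp_of_cubes` turns Theorem 3.7 into the (3.42) block
`EBlock (kernelFamilySInv i B cfg G′ par) … U₁` of the reading of `G′(U)` over the invariant class for ANY finite family of terms `T_□` with DISPLAYED block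
majorants of `η²T_□` (`hT`), of the commutator terms `R_□` (`h389`), of `∇_{inl μ}·η²T_□` (`hTE μ`), of `η⁻²Δ·η²T_□` (`hTL`), of `η²T_□·∇_{inr μ}` (`hTF μ`) and of
the transposed commutator terms `V_□` (`hV`), with their overlap sums.  Here the family is THE CUBE COVER OF RECORD: `T_□ = h_□O_□(U₁)h_□` for cube letters
`O_□` (= `G′_□`) whose Cor.-3.6 bounds at `U₁` are given as their (3.42) blocks over the class (`hE : ∀ □, EBlock (kernelFamilySInv i B cfg O_□ par) B₀ δ₀ U₁`),
and the five per-cube inputs are DISCHARGED: `hT` by FILE 3 `hT_of_eBlockInv_cube`; `h389` by p38's `B9Thm37CommutatorBound389Majorant.hasMajorant_conj_of_bound389`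
(as in FILE 3); `hTE μ`∕`hTL` by FILE 4a `B9Thm37CutoffGradTerms.hasMajorant_conj_gradTerm`∕`hasMajorant_conj_lapTerm` and `hTF μ` by FILE 4b
`B9Thm37CutoffDivTerms.hasMajorant_conj_divTerm`, after the three letter unfoldings of §1 (def-Y's `OpsYRead342.gradF_mul_apply`∕`lap_mul_apply`∕
`mul_neg_gradB_apply` at the cube operator `Λ ↦ h_□O_□(h_□Λ)`), all localized on `S_□ = {a : βa ∈ QT □}` (FILE 3 `SQT`) whose overlap count is
`3·5^{d+1}` (`hcnt_SQT`).  What stays displayed, exactly as print's p. 410 sentence leaves it to «Corollary 3.6 holding for all G′_□» and to the algebra of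
pp. 409–410: `G′Δ′_a = 1` (`hinv`), (3.88) (`h388`) and its transposed reading (`h388T`) with the transposed commutator terms `V_□` and their scale-weighted
majorants (`hV`, `hKV`, `θ_V`), the bond variables and averaging transporters bi-contractive at `U₁`, `η = |c_f|⁻¹`, a bound `m_N` on the number of index
bonds within distance `1` of a bond (`Tn`, `hTn`, `hnbr`; [4] (2.61)), [4] Lemma 2.1 for the member at exponent `α` (`h261`, `h263`, `0 ≤ αδ₀`,
`0 ≤ (1−2α)δ₀`) and the two located smallness conditions («M sufficiently large»).

WHAT IS PROVED (all `theorem`s, no `sorry`).  §1 `sum_ite_SQT_le` (overlap sums of localized majorants), `gradF_mul_cube_apply`, `lap_mul_cube_apply`,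
`cube_mul_neg_gradB_apply` (the three letter unfoldings at the cube operator); §2 ★★ `eBlock_kernelFamilySInv_Gp_of_cubeCover` — the (3.42) block of the
reading of `G′(U)` over the invariant class at `U₁`, constant
`M₂(Σ‖b_j‖)·[(N·B₀′ + A₁ + A₃)·c₁(α)(1 − Nθc₁(α))⁻¹ + A₂·c₁(α)(1 − θ_Vc₁(α))⁻¹]` with `N = 3·5^{d+1}`, `B₀′ = M₂(Σ‖b_j‖)B₀`, `θ = M₂(Σ‖b_j‖)θ₃₈₉∕(L·M_h)`,
`A₁ = N·M₂(Σ‖b_j‖)·B₀(1 + (5∕8)C1F∕M_h)`, `A₂ = N·M₂(Σ‖b_j‖)·B₀(1 + m_Ne^{δ₀}(5∕8)C1F∕M_h)`, `A₃ = N·M₂(Σ‖b_j‖)·(B₀ + θ₃₈₉∕(L·M_h))`, rate `(1−2α)δ₀`.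
-/

noncomputable section

namespace Literature.MathematicalPhysics.QuantumFieldTheory.Balaban1983to89.B9Thm37GpTorusRegularEntriesCubes

open Node00 B9CubeLettersInvReadings B9CubeLettersInvReadDict B9Thm37GpTorusRegular B9Thm37GpTorusRegularEntries
open B9Thm37GpTorusRegularCubes (SQT mem_SQT hcnt_SQT hT_of_eBlockInv_cube)
open B9Thm37CutoffGradTerms (hasMajorant_conj_gradTerm hasMajorant_conj_lapTerm)
open B9Thm37CutoffDivTerms (hasMajorant_conj_divTerm)
open B9Thm37CubeCoverCommutators (cutMulY cutMulY_apply hTY KhY)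
open B9Thm37CommutatorBound389 (theta389 theta389_nonneg)
open B9Thm37CommutatorBound389Majorant (hasMajorant_conj_of_bound389)
open B9Thm37CubeCoverCommutatorSizes (side_conditions four_le_P')
open B6Geom246MultiLevelBox (bset blkOf)
open B6Cover236MultiLevelBlocks (cubes)
open B6Partition118KLevelTorusCentral (QT)
open B6Partition118KLevelFineSizes (C1F C1F_nonneg)
open B6Ineq2142KLevelV1 (β)
open B6KLevelCensusIndexV1 (KIdx)
open B6RandomWalk (HasMajorant Triangle254 Ineq261 Ineq263 hasMajorant_mono)
open B9Thm34Ext (toB6)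
open B9FromB6 (EBlock)
open B9GeoNormsKLevelV1 (geo9K geo9K_supNorm_nonneg)
open B9Eq352DivFormLetters (conj gradLetterF gradLetterB)
open B9Eq352GradLetters (diffLetter diffLetter_inl diffLetter_inr)
open B9Ineq349SiteComposite (etaS_pos)
open scoped Matrix

variable {d ℓ : ℕ} {hd : 1 ≤ d + 1} {hL : Odd (ℓ + 1) ∧ 1 < ℓ + 1} {b₀ b₁ : ℝ}
variable {𝔸 : Type} [NormedRing 𝔸] [NormedAlgebra ℂ 𝔸] [CompleteSpace 𝔸]
variable {ι : Type} [Fintype ι] [DecidableEq ι]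
variable (i : KIdx d ℓ hd hL b₀ b₁) (b : Module.Basis ι ℝ 𝔸)
variable [Fintype (geo9K i).Site] [DecidableEq (geo9K i).Site] {Rr : ℝ} {Hp : Prop}
variable {B : B9.Backgrounds} (cfg : B.Cfg → CfgY 𝔸 i) (parS : SiteParY 𝔸 i) {U₁ : B.Cfg}

/-! ## §1 Overlap sums of localized majorants; the three letter unfoldings at the cube operator `Λ ↦ h_□O_□(h_□Λ)` -/

omit [CompleteSpace 𝔸] [DecidableEq ι] in
/-- **THE OVERLAP SUM OF A LOCALIZED MAJORANT**: `Σ_□ 1_{S_□}(a)·X ≤ 3·5^{d+1}·X` for `X ≥ 0` (FILE 3 `hcnt_SQT`).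
[cite: Balaban1985BackgroundPropagators, (3.91) p.410; Balaban1984PropagatorsII, p.235] -/
theorem sum_ite_SQT_le (a : (geo9K i).Site) {X : ℝ} (hX : 0 ≤ X) :
    (∑ c : ↥(cubes i.D.toDomains), if a ∈ SQT i c then X else 0) ≤ 3 * 5 ^ (d + 1) * X := by
  calc (∑ c : ↥(cubes i.D.toDomains), if a ∈ SQT i c then X else 0)
      = ∑ c : ↥(cubes i.D.toDomains), (if a ∈ SQT i c then (1 : ℝ) else 0) * X :=
        Finset.sum_congr rfl fun c _ => by split_ifs <;> simp
    _ = (∑ c : ↥(cubes i.D.toDomains), if a ∈ SQT i c then (1 : ℝ) else 0) * X := (Finset.sum_mul _ _ _).symm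
    _ ≤ 3 * 5 ^ (d + 1) * X := mul_le_mul_of_nonneg_right (hcnt_SQT i a) hX

omit [Fintype ι] [DecidableEq ι] [Fintype (geo9K i).Site] [DecidableEq (geo9K i).Site] in
/-- **`∇_{inl μ}·(η²·h_□O_□h_□) = η·∇_{V,μ}(h_□O_□(h_□·))`** (def-Y's `gradF_mul_apply` at the cube operator).
[cite: Balaban1985BackgroundPropagators, (3.3) p.390, (3.87) p.409, (3.42) p.397 (second member)] -/
theorem gradF_mul_cube_apply (V : CfgY 𝔸 i) (O : (SiteY i → 𝔸) →ₗ[ℂ] (SiteY i → 𝔸)) (h : SiteY i → ℝ) (μ : Fin (d + 1))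
    (Λ : SiteY i → 𝔸) (z : SiteY i) :
    (gradLetterF (shiftY i) (UboxY i V) ((((etaS i : ℝ) : ℂ))⁻¹) μ *
        ((etaS i ^ 2) • ((cutMulY (𝔸 := 𝔸) h).restrictScalars ℝ * O.restrictScalars ℝ * (cutMulY (𝔸 := 𝔸) h).restrictScalars ℝ))) Λ z
      = ((etaS i : ℝ) : ℂ) • cdS i V μ (cutMulY h (O (cutMulY h Λ))) z :=
  OpsYRead342.gradF_mul_apply i (fun _ => (cutMulY (𝔸 := 𝔸) h) ∘ₗ O ∘ₗ (cutMulY (𝔸 := 𝔸) h)) V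
    ((etaS i ^ 2) • ((cutMulY (𝔸 := 𝔸) h).restrictScalars ℝ * O.restrictScalars ℝ * (cutMulY (𝔸 := 𝔸) h).restrictScalars ℝ))
    (fun _ => rfl) μ Λ z

omit [Fintype ι] [DecidableEq ι] [Fintype (geo9K i).Site] [DecidableEq (geo9K i).Site] in
/-- **`(η⁻²Δ_V)·(η²·h_□O_□h_□) = Δ_V(h_□O_□(h_□·))`** (def-Y's `lap_mul_apply` at the cube operator).
[cite: Balaban1985BackgroundPropagators, (3.23) p.394, (3.87) p.409, (3.42) p.397 (fourth member)] -/
theorem lap_mul_cube_apply (V : CfgY 𝔸 i) (O : (SiteY i → 𝔸) →ₗ[ℂ] (SiteY i → 𝔸)) (h : SiteY i → ℝ) (Λ : SiteY i → 𝔸) (z : SiteY i) :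
    (((etaS i ^ 2)⁻¹ • (lapSL i V).restrictScalars ℝ) *
        ((etaS i ^ 2) • ((cutMulY (𝔸 := 𝔸) h).restrictScalars ℝ * O.restrictScalars ℝ * (cutMulY (𝔸 := 𝔸) h).restrictScalars ℝ))) Λ z
      = lapS i V (cutMulY h (O (cutMulY h Λ))) z :=
  OpsYRead342.lap_mul_apply i (fun _ => (cutMulY (𝔸 := 𝔸) h) ∘ₗ O ∘ₗ (cutMulY (𝔸 := 𝔸) h)) V
    ((etaS i ^ 2) • ((cutMulY (𝔸 := 𝔸) h).restrictScalars ℝ * O.restrictScalars ℝ * (cutMulY (𝔸 := 𝔸) h).restrictScalars ℝ))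
    ((etaS i ^ 2)⁻¹ • (lapSL i V).restrictScalars ℝ) (fun _ => rfl) (fun _ => rfl) Λ z

omit [Fintype ι] [DecidableEq ι] [Fintype (geo9K i).Site] [DecidableEq (geo9K i).Site] in
/-- **`(η²·h_□O_□h_□)·∇_{inr μ} = −η·h_□O_□(h_□∇*_{V,μ}·)`** (`∇_{inr μ} = −η⁻¹∇*_{V,μ}`; def-Y's `mul_neg_gradB_apply` at the cube operator).
[cite: Balaban1985BackgroundPropagators, (3.8) p.392, (3.87) p.409, (3.42) p.397 (third member)] -/
theorem cube_mul_neg_gradB_apply (V : CfgY 𝔸 i) (O : (SiteY i → 𝔸) →ₗ[ℂ] (SiteY i → 𝔸)) (h : SiteY i → ℝ) (μ : Fin (d + 1))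
    (Λ : SiteY i → 𝔸) (z : SiteY i) :
    (((etaS i ^ 2) • ((cutMulY (𝔸 := 𝔸) h).restrictScalars ℝ * O.restrictScalars ℝ * (cutMulY (𝔸 := 𝔸) h).restrictScalars ℝ)) *
        -gradLetterB (shiftY i) (UboxY i V) ((((etaS i : ℝ) : ℂ))⁻¹) μ) Λ z
      = -(((etaS i : ℝ) : ℂ) • cutMulY h (O (cutMulY h (cdsS i V μ Λ))) z) :=
  OpsYRead342.mul_neg_gradB_apply i (fun _ => (cutMulY (𝔸 := 𝔸) h) ∘ₗ O ∘ₗ (cutMulY (𝔸 := 𝔸) h)) V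
    ((etaS i ^ 2) • ((cutMulY (𝔸 := 𝔸) h).restrictScalars ℝ * O.restrictScalars ℝ * (cutMulY (𝔸 := 𝔸) h).restrictScalars ℝ))
    (fun _ => rfl) μ Λ z

/-! ## §2 ★★ Theorem 3.7 ⇒ the (3.42) block of the reading of `G′(U)` over the class, at the cube cover of record -/

/-- ★★ **THEOREM 3.7 ⇒ ALL FOUR INEQUALITIES (3.42) FOR `G′(U)` AT THE CUBE COVER OF RECORD, AS THE (3.42) BLOCK OF THE READING OVER THE INVARIANT
CLASS.**  Inputs: the cube letters `O_□` with Cor. 3.6 at `U₁` in the form of their (3.42) blocks over the class (`hE`), the (3.89) commutator terms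
`R_□ = K(h_□)O_□h_□` (`hR`), `G′Δ′_a = 1` (`hinv`), (3.88) (`h388`) and its transposed reading with the terms `V_□` (`h388T`, `hV`, `hKV`), the bond variables
and the averaging transporters bi-contractive at `U₁`, `η = |c_f|⁻¹`, a corner-free section `ιB` of `β`, a real basis `b` with coordinate bound `M₂`, a bound
`m_N` on the index bonds within `1` of a bond, [4] Lemma 2.1 at exponent `α` for the member, and the located smallness conditions
`3·5^{d+1}·θ·c₁(α) < 1` (`θ = M₂(Σ‖b_j‖)θ₃₈₉∕(L·M_h)`) and `θ_V·c₁(α) < 1` («M sufficiently large»).  Output: `EBlock (kernelFamilySInv i B cfg G′ par) (M₂(Σ‖b_j‖)·Bc)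
((1−2α)δ₀) U₁` with `Bc = (N·B₀′ + A₁ + A₃)·c₁(1 − Nθc₁)⁻¹ + A₂·c₁(1 − θ_Vc₁)⁻¹` written term by term (`N = 3·5^{d+1}`, `B₀′ = M₂(Σ‖b_j‖)B₀`,
`A₁ = N·M₂(Σ‖b_j‖)B₀(1 + (5∕8)C1F∕M_h)`, `A₂ = N·M₂(Σ‖b_j‖)B₀(1 + m_Ne^{δ₀}(5∕8)C1F∕M_h)`, `A₃ = N·M₂(Σ‖b_j‖)(B₀ + θ₃₈₉∕(L·M_h))`; p. 403 «of course with
different constants», p. 410 «a decay rate arbitrarily close»).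
[cite: Balaban1985BackgroundPropagators, Thm 3.7 (3.87)–(3.90) pp.409–410 ⇒ Thm 3.1 (3.42) p.397, Cor. 3.6 p.408; Balaban1984PropagatorsII, Prop 2.2 (2.65)–(2.67) p.234, Lemma 2.1 (2.61) p.234] -/
theorem eBlock_kernelFamilySInv_Gp_of_cubeCover (ιB : BlkY i → IBondY i) (hι : ∀ s, β i.hN i.D i.hk (ιB s) = s)
    {M₂ : ℝ} (hM₂ : 0 ≤ M₂) (hrepr : ∀ (v : 𝔸) (j : ι), |b.repr v j| ≤ M₂ * ‖v‖) (hη : etaS i = |i.cf|⁻¹)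
    (Gp : SiteOpY 𝔸 i) (Oc : ↥(cubes i.D.toDomains) → SiteOpY 𝔸 i) {Δ : Module.End ℝ (SiteY i → 𝔸)}
    (R V : ↥(cubes i.D.toDomains) → Module.End ℝ (SiteY i → 𝔸))
    (hR : ∀ c Λ, R c Λ = KhY i parS (hTY i c) (cfg U₁) (Oc c (cfg U₁) (cutMulY (hTY i c) Λ)))
    (KV : ↥(cubes i.D.toDomains) → (geo9K i).Site → (geo9K i).Site → ℝ)
    (hinv : (Gp (cfg U₁)).restrictScalars ℝ * Δ = 1)
    (h388 : Δ * (∑ c, (cutMulY (𝔸 := 𝔸) (hTY i c)).restrictScalars ℝ * (Oc c (cfg U₁)).restrictScalars ℝ *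
      (cutMulY (𝔸 := 𝔸) (hTY i c)).restrictScalars ℝ) = 1 - ∑ c, R c)
    (h388T : (∑ c, (cutMulY (𝔸 := 𝔸) (hTY i c)).restrictScalars ℝ * (Oc c (cfg U₁)).restrictScalars ℝ *
      (cutMulY (𝔸 := 𝔸) (hTY i c)).restrictScalars ℝ) * Δ = 1 - ∑ c, V c)
    {B₀ δ₀ : ℝ} (hB₀ : 0 ≤ B₀) (hδ₀ : 0 ≤ δ₀) (hE : ∀ c, EBlock (kernelFamilySInv i B cfg (Oc c) parS) B₀ δ₀ U₁)
    (hVb : ∀ (μ : Fin (d + 1)) (x : SiteY i), ‖(UboxY i (cfg U₁) μ x : 𝔸)‖ ≤ 1 ∧ ‖(((UboxY i (cfg U₁) μ x)⁻¹ : 𝔸ˣ) : 𝔸)‖ ≤ 1)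
    (hTr : ∀ z w : SiteY i, ‖(avgTrY i parS (cfg U₁) z w : 𝔸)‖ ≤ 1 ∧ ‖(((avgTrY i parS (cfg U₁) z w)⁻¹ : 𝔸ˣ) : 𝔸)‖ ≤ 1)
    (Tn : IBondY i → Finset (IBondY i)) (hTn : ∀ a y' : IBondY i, (geo9K i).dist a y' ≤ 1 → a ∈ Tn y')
    {mN : ℕ} (hnbr : ∀ y' : IBondY i, (Tn y').card ≤ mN)
    (d' : ℕ) {α θV : ℝ} (hθV : 0 ≤ θV) (hαδ : 0 ≤ α * δ₀) (hαδ2 : 0 ≤ (1 - 2 * α) * δ₀)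
    (h261 : Ineq261 d' (toB6 (geo9K i) Rr Hp) δ₀ α) (h263 : Ineq263 d' (toB6 (geo9K i) Rr Hp) δ₀ α)
    (hsmall : (3 * 5 ^ (d + 1)) * (M₂ * (∑ j, ‖b j‖) * (theta389 d ℓ B₀ δ₀ / (((ℓ : ℝ) + 1) * i.Mh))) * B6.c1 d' δ₀ α < 1)
    (hsmallV : θV * B6.c1 d' δ₀ α < 1)
    (hV : ∀ c, HasMajorant (g := toB6 (geo9K i) Rr Hp) (fun p : SiteY i × ι => ιB (blkOf i.D.toDomains p.1)) (conj b (V c)) (KV c))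
    (hKV : ∀ a a', (∑ c, KV c a a') ≤ θV * (geo9K i).len a * ((geo9K i).len a')⁻¹ * Real.exp (-(δ₀ * (geo9K i).dist a a'))) :
    EBlock (kernelFamilySInv i B cfg Gp parS)
      (M₂ * (∑ j, ‖b j‖) *
        ((3 * 5 ^ (d + 1)) * (M₂ * (∑ j, ‖b j‖) * B₀) * B6.c1 d' δ₀ α *
            (1 - (3 * 5 ^ (d + 1)) * (M₂ * (∑ j, ‖b j‖) * (theta389 d ℓ B₀ δ₀ / (((ℓ : ℝ) + 1) * i.Mh))) * B6.c1 d' δ₀ α)⁻¹ +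
          (3 * 5 ^ (d + 1)) * (M₂ * (∑ j, ‖b j‖) * (B₀ * (1 + 5 / 8 * C1F d ℓ / i.Mh))) * B6.c1 d' δ₀ α *
            (1 - (3 * 5 ^ (d + 1)) * (M₂ * (∑ j, ‖b j‖) * (theta389 d ℓ B₀ δ₀ / (((ℓ : ℝ) + 1) * i.Mh))) * B6.c1 d' δ₀ α)⁻¹ +
          (3 * 5 ^ (d + 1)) * (M₂ * (∑ j, ‖b j‖) * (B₀ * (1 + (mN : ℝ) * Real.exp δ₀ * (5 / 8 * C1F d ℓ / i.Mh)))) * B6.c1 d' δ₀ α *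
            (1 - θV * B6.c1 d' δ₀ α)⁻¹ +
          (3 * 5 ^ (d + 1)) * (M₂ * (∑ j, ‖b j‖) * (B₀ + theta389 d ℓ B₀ δ₀ / (((ℓ : ℝ) + 1) * i.Mh))) * B6.c1 d' δ₀ α *
            (1 - (3 * 5 ^ (d + 1)) * (M₂ * (∑ j, ‖b j‖) * (theta389 d ℓ B₀ δ₀ / (((ℓ : ℝ) + 1) * i.Mh))) * B6.c1 d' δ₀ α)⁻¹))
      ((1 - 2 * α) * δ₀) U₁ := by
  obtain ⟨_, hMh2, _, _⟩ := side_conditions i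
  have hM : (0 : ℝ) < i.Mh := by exact_mod_cast (lt_of_lt_of_le (by norm_num) hMh2)
  have hC : 0 ≤ C1F d ℓ := C1F_nonneg d ℓ
  have hθ389 : 0 ≤ theta389 d ℓ B₀ δ₀ := theta389_nonneg d ℓ hB₀ δ₀
  have hSb : 0 ≤ ∑ j, ‖b j‖ := Finset.sum_nonneg fun _ _ => norm_nonneg _
  have hB₀' : 0 ≤ M₂ * (∑ j, ‖b j‖) * B₀ := mul_nonneg (mul_nonneg hM₂ hSb) hB₀
  have hθ : 0 ≤ M₂ * (∑ j, ‖b j‖) * (theta389 d ℓ B₀ δ₀ / (((ℓ : ℝ) + 1) * i.Mh)) :=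
    mul_nonneg (mul_nonneg hM₂ hSb) (div_nonneg hθ389 (by positivity))
  have hN : (0 : ℝ) ≤ 3 * 5 ^ (d + 1) := by positivity
  have hθE : 0 ≤ M₂ * (∑ j, ‖b j‖) * (B₀ * (1 + 5 / 8 * C1F d ℓ / i.Mh)) := by positivity
  have hθF : 0 ≤ M₂ * (∑ j, ‖b j‖) * (B₀ * (1 + (mN : ℝ) * Real.exp δ₀ * (5 / 8 * C1F d ℓ / i.Mh))) := by positivity
  have hθL : 0 ≤ M₂ * (∑ j, ‖b j‖) * (B₀ + theta389 d ℓ B₀ δ₀ / (((ℓ : ℝ) + 1) * i.Mh)) :=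
    mul_nonneg (mul_nonneg hM₂ hSb) (add_nonneg hB₀ (div_nonneg hθ389 (by positivity)))
  have hA₁ : 0 ≤ 3 * 5 ^ (d + 1) * (M₂ * (∑ j, ‖b j‖) * (B₀ * (1 + 5 / 8 * C1F d ℓ / i.Mh))) := mul_nonneg hN hθE
  have hA₂ : 0 ≤ 3 * 5 ^ (d + 1) * (M₂ * (∑ j, ‖b j‖) * (B₀ * (1 + (mN : ℝ) * Real.exp δ₀ * (5 / 8 * C1F d ℓ / i.Mh)))) := mul_nonneg hN hθF
  have hA₃ : 0 ≤ 3 * 5 ^ (d + 1) * (M₂ * (∑ j, ‖b j‖) * (B₀ + theta389 d ℓ B₀ δ₀ / (((ℓ : ℝ) + 1) * i.Mh))) := mul_nonneg hN hθL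
  -- the cube letters' (3.42) entries over the class, READ pointwise (D1 §3)
  have h342₀ : ∀ (c : ↥(cubes i.D.toDomains)) (f : SiteY i → ℝ) (y y' : IBondY i), (geo9K i).suppIn (Sum.inl f) y' →
      ∀ Λ : SiteY i → 𝔸, (∀ z, ‖Λ z‖ ≤ |f z|) → ∀ z : SiteY i, blkOf i.D.toDomains z = β i.hN i.D i.hk y →
        etaS i ^ 2 * ‖Oc c (cfg U₁) Λ z‖ ≤ B₀ * (geo9K i).len y ^ 2 * Real.exp (-(δ₀ * (geo9K i).dist y y')) * (geo9K i).supNorm (Sum.inl f) :=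
    fun c f y y' hs Λ hΛ z hz => sq_eta_mul_norm_le_of_eBlockInv i b cfg (Oc c) parS (hE c) hM₂ hrepr f y y' hs ⟨Λ, hΛ⟩ hz
  have h342₁ : ∀ (c : ↥(cubes i.D.toDomains)) (f : SiteY i → ℝ) (y y' : IBondY i), (geo9K i).suppIn (Sum.inl f) y' →
      ∀ Λ : SiteY i → 𝔸, (∀ z, ‖Λ z‖ ≤ |f z|) → ∀ (z : SiteY i) (μ : Fin (d + 1)), blkOf i.D.toDomains z = β i.hN i.D i.hk y →
        etaS i * ‖cdS i (cfg U₁) μ (Oc c (cfg U₁) Λ) z‖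
          ≤ B₀ * (geo9K i).len y * Real.exp (-(δ₀ * (geo9K i).dist y y')) * (geo9K i).supNorm (Sum.inl f) :=
    fun c f y y' hs Λ hΛ z μ hz => eta_mul_norm_cdS_le_of_eBlockInv i b cfg (Oc c) parS (hE c) hM₂ hrepr f y y' hs ⟨Λ, hΛ⟩ μ hz
  have h342₂ : ∀ (c : ↥(cubes i.D.toDomains)) (f : SiteY i → ℝ) (y y' : IBondY i), (geo9K i).suppIn (Sum.inl f) y' →
      ∀ Λ : SiteY i → 𝔸, (∀ z, ‖Λ z‖ ≤ |f z|) → ∀ (z : SiteY i) (μ : Fin (d + 1)), blkOf i.D.toDomains z = β i.hN i.D i.hk y →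
        etaS i * ‖Oc c (cfg U₁) (cdsS i (cfg U₁) μ Λ) z‖
          ≤ B₀ * (geo9K i).len y * Real.exp (-(δ₀ * (geo9K i).dist y y')) * (geo9K i).supNorm (Sum.inl f) :=
    fun c f y y' hs Λ hΛ z μ hz => eta_mul_norm_cdsS_le_of_eBlockInv i b cfg (Oc c) parS (hE c) hM₂ hrepr f y y' hs ⟨Λ, hΛ⟩ μ hz
  have h342₃ : ∀ (c : ↥(cubes i.D.toDomains)) (f : SiteY i → ℝ) (y y' : IBondY i), (geo9K i).suppIn (Sum.inl f) y' →
      ∀ Λ : SiteY i → 𝔸, (∀ z, ‖Λ z‖ ≤ |f z|) → ∀ z : SiteY i, blkOf i.D.toDomains z = β i.hN i.D i.hk y →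
        ‖lapS i (cfg U₁) (Oc c (cfg U₁) Λ) z‖ ≤ B₀ * 1 * Real.exp (-(δ₀ * (geo9K i).dist y y')) * (geo9K i).supNorm (Sum.inl f) :=
    fun c f y y' hs Λ hΛ z hz => norm_lapS_le_of_eBlockInv i b cfg (Oc c) parS (hE c) hM₂ hrepr f y y' hs ⟨Λ, hΛ⟩ hz
  -- `hT`: FILE 3; `h389`: p38's (3.89) majorant for every cube (as in FILE 3)
  have hT := fun c => hT_of_eBlockInv_cube i b cfg parS (Rr := Rr) (Hp := Hp) ιB hι hM₂ hrepr (Oc c) hB₀ (hE c) c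
  have h389 : ∀ c, HasMajorant (g := toB6 (geo9K i) Rr Hp) (fun p : SiteY i × ι => ιB (blkOf i.D.toDomains p.1)) (conj b (R c))
      (fun a a' => if a ∈ SQT i c then M₂ * (∑ j, ‖b j‖) * (theta389 d ℓ B₀ δ₀ / (((ℓ : ℝ) + 1) * i.Mh)) *
        Real.exp (-(δ₀ * (geo9K i).dist a a')) else 0) := fun c => by
    convert hasMajorant_conj_of_bound389 i b parS c (cfg U₁) (Oc c (cfg U₁)) hB₀ hδ₀ hη ιB hι hVb hTr (h342₀ c) (h342₁ c)
      hM₂ hrepr (R c) (hR c) (SQT i c) (fun a ha => (mem_SQT i c a).2 ha) using 3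
    split_ifs <;> first | rfl | contradiction
  -- `hTE μ`, `hTL`, `hTF μ`: FILES 4a∕4b after the letter unfoldings of §1
  have hTE : ∀ (μ : Fin (d + 1)) (c : ↥(cubes i.D.toDomains)),
      HasMajorant (g := toB6 (geo9K i) Rr Hp) (fun p : SiteY i × ι => ιB (blkOf i.D.toDomains p.1))
        (conj b (diffLetter (shiftY i) (UboxY i (cfg U₁)) (((etaS i : ℂ))⁻¹) (Sum.inl μ)) *
          conj b ((etaS i ^ 2) • ((cutMulY (𝔸 := 𝔸) (hTY i c)).restrictScalars ℝ * (Oc c (cfg U₁)).restrictScalars ℝ *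
            (cutMulY (𝔸 := 𝔸) (hTY i c)).restrictScalars ℝ)))
        (fun a a' => if a ∈ SQT i c then M₂ * (∑ j, ‖b j‖) * (B₀ * (1 + 5 / 8 * C1F d ℓ / i.Mh)) * (geo9K i).len a *
          Real.exp (-(δ₀ * (geo9K i).dist a a')) else 0) := fun μ c => by
    rw [← B9Eq352DivFormLetters.conj_mul, diffLetter_inl]
    convert hasMajorant_conj_gradTerm i b (cfg U₁) (Oc c (cfg U₁)) (Rr := Rr) (Hp := Hp) c μ hB₀ hη ιB hι (h342₀ c) (h342₁ c) hM₂ hrepr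
      _ (gradF_mul_cube_apply i (cfg U₁) (Oc c (cfg U₁)) (hTY i c) μ) (SQT i c) (fun a ha => (mem_SQT i c a).2 ha) using 3
    split_ifs <;> first | rfl | contradiction
  have hTL : ∀ (c : ↥(cubes i.D.toDomains)),
      HasMajorant (g := toB6 (geo9K i) Rr Hp) (fun p : SiteY i × ι => ιB (blkOf i.D.toDomains p.1))
        (conj b ((etaS i ^ 2)⁻¹ • (lapSL i (cfg U₁)).restrictScalars ℝ) *
          conj b ((etaS i ^ 2) • ((cutMulY (𝔸 := 𝔸) (hTY i c)).restrictScalars ℝ * (Oc c (cfg U₁)).restrictScalars ℝ *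
            (cutMulY (𝔸 := 𝔸) (hTY i c)).restrictScalars ℝ)))
        (fun a a' => if a ∈ SQT i c then M₂ * (∑ j, ‖b j‖) * (B₀ + theta389 d ℓ B₀ δ₀ / (((ℓ : ℝ) + 1) * i.Mh)) *
          Real.exp (-(δ₀ * (geo9K i).dist a a')) else 0) := fun c => by
    rw [← B9Eq352DivFormLetters.conj_mul]
    convert hasMajorant_conj_lapTerm i b (cfg U₁) (Oc c (cfg U₁)) (Rr := Rr) (Hp := Hp) c hB₀ hδ₀ hη ιB hι hVb (h342₀ c) (h342₁ c) (h342₃ c)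
      hM₂ hrepr _ (lap_mul_cube_apply i (cfg U₁) (Oc c (cfg U₁)) (hTY i c)) (SQT i c) (fun a ha => (mem_SQT i c a).2 ha) using 3
    split_ifs <;> first | rfl | contradiction
  have hTF : ∀ (μ : Fin (d + 1)) (c : ↥(cubes i.D.toDomains)),
      HasMajorant (g := toB6 (geo9K i) Rr Hp) (fun p : SiteY i × ι => ιB (blkOf i.D.toDomains p.1))
        (conj b ((etaS i ^ 2) • ((cutMulY (𝔸 := 𝔸) (hTY i c)).restrictScalars ℝ * (Oc c (cfg U₁)).restrictScalars ℝ *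
            (cutMulY (𝔸 := 𝔸) (hTY i c)).restrictScalars ℝ)) *
          conj b (diffLetter (shiftY i) (UboxY i (cfg U₁)) (((etaS i : ℂ))⁻¹) (Sum.inr μ)))
        (fun a a' => if a ∈ SQT i c then M₂ * (∑ j, ‖b j‖) * (B₀ * (1 + (mN : ℝ) * Real.exp δ₀ * (5 / 8 * C1F d ℓ / i.Mh))) *
          (geo9K i).len a * Real.exp (-(δ₀ * (geo9K i).dist a a')) else 0) := fun μ c => by
    rw [← B9Eq352DivFormLetters.conj_mul, diffLetter_inr]
    convert hasMajorant_conj_divTerm i b (cfg U₁) (Oc c (cfg U₁)) (Rr := Rr) (Hp := Hp) c μ hB₀ hδ₀ hη ιB hι hVb (h342₀ c) (h342₂ c)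
      Tn hTn hnbr hM₂ hrepr _ (cube_mul_neg_gradB_apply i (cfg U₁) (Oc c (cfg U₁)) (hTY i c) μ) (SQT i c)
      (fun a ha => (mem_SQT i c a).2 ha) using 3
    split_ifs <;> first | rfl | contradiction
  -- the overlap sums of the localized majorants
  have hKE : ∀ (μ : Fin (d + 1)) (a a' : (geo9K i).Site),
      (∑ c : ↥(cubes i.D.toDomains), (if a ∈ SQT i c then M₂ * (∑ j, ‖b j‖) * (B₀ * (1 + 5 / 8 * C1F d ℓ / i.Mh)) * (geo9K i).len a *
          Real.exp (-(δ₀ * (geo9K i).dist a a')) else 0))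
        ≤ 3 * 5 ^ (d + 1) * (M₂ * (∑ j, ‖b j‖) * (B₀ * (1 + 5 / 8 * C1F d ℓ / i.Mh))) * (geo9K i).len a *
          Real.exp (-(δ₀ * (geo9K i).dist a a')) := fun μ a a' => by
    have hl := (B6KLevelCensusIndexV1.len_pos i a).le
    exact (sum_ite_SQT_le i a (by positivity)).trans (le_of_eq (by ring))
  have hKL : ∀ (a a' : (geo9K i).Site),
      (∑ c : ↥(cubes i.D.toDomains), (if a ∈ SQT i c then M₂ * (∑ j, ‖b j‖) * (B₀ + theta389 d ℓ B₀ δ₀ / (((ℓ : ℝ) + 1) * i.Mh)) *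
          Real.exp (-(δ₀ * (geo9K i).dist a a')) else 0))
        ≤ 3 * 5 ^ (d + 1) * (M₂ * (∑ j, ‖b j‖) * (B₀ + theta389 d ℓ B₀ δ₀ / (((ℓ : ℝ) + 1) * i.Mh))) * 1 *
          Real.exp (-(δ₀ * (geo9K i).dist a a')) := fun a a' =>
    (sum_ite_SQT_le i a (mul_nonneg hθL (Real.exp_pos _).le)).trans (le_of_eq (by ring))
  have hKF : ∀ (μ : Fin (d + 1)) (a a' : (geo9K i).Site),
      (∑ c : ↥(cubes i.D.toDomains), (if a ∈ SQT i c then M₂ * (∑ j, ‖b j‖) * (B₀ * (1 + (mN : ℝ) * Real.exp δ₀ * (5 / 8 * C1F d ℓ / i.Mh))) *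
          (geo9K i).len a * Real.exp (-(δ₀ * (geo9K i).dist a a')) else 0))
        ≤ 3 * 5 ^ (d + 1) * (M₂ * (∑ j, ‖b j‖) * (B₀ * (1 + (mN : ℝ) * Real.exp δ₀ * (5 / 8 * C1F d ℓ / i.Mh)))) * (geo9K i).len a *
          Real.exp (-(δ₀ * (geo9K i).dist a a')) := fun μ a a' => by
    have hl := (B6KLevelCensusIndexV1.len_pos i a).le
    exact (sum_ite_SQT_le i a (by positivity)).trans (le_of_eq (by ring))
  exact eBlock_kernelFamilySInv_Gp_of_cubes i b ιB cfg Gp parS hι hM₂ hrepr rfl ((lapSL i (cfg U₁)).restrictScalars ℝ) (fun _ => rfl) d'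
    (fun c => SQT i c) (fun c => SQT i c)
    (fun c => (cutMulY (𝔸 := 𝔸) (hTY i c)).restrictScalars ℝ * (Oc c (cfg U₁)).restrictScalars ℝ * (cutMulY (𝔸 := 𝔸) (hTY i c)).restrictScalars ℝ)
    R V
    (fun _ c a a' => if a ∈ SQT i c then M₂ * (∑ j, ‖b j‖) * (B₀ * (1 + 5 / 8 * C1F d ℓ / i.Mh)) * (geo9K i).len a *
      Real.exp (-(δ₀ * (geo9K i).dist a a')) else 0)
    (fun _ c a a' => if a ∈ SQT i c then M₂ * (∑ j, ‖b j‖) * (B₀ * (1 + (mN : ℝ) * Real.exp δ₀ * (5 / 8 * C1F d ℓ / i.Mh))) *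
      (geo9K i).len a * Real.exp (-(δ₀ * (geo9K i).dist a a')) else 0)
    (fun c a a' => if a ∈ SQT i c then M₂ * (∑ j, ‖b j‖) * (B₀ + theta389 d ℓ B₀ δ₀ / (((ℓ : ℝ) + 1) * i.Mh)) *
      Real.exp (-(δ₀ * (geo9K i).dist a a')) else 0)
    KV hB₀' hθ hθV hN hN hA₁ hA₂ hA₃ hαδ hαδ2 h261 h263 hsmall hsmallV hT (hcnt_SQT i) h389 (hcnt_SQT i)
    hTE hKE hTL hKL hTF hKF hV hKV hinv h388 h388T

end Literature.MathematicalPhysics.QuantumFieldTheory.Balaban1983to89.B9Thm37GpTorusRegularEntriesCubes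

end
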